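import Literature.AnabelianGeometry.SemiGraphs.TemperedPiEdgeConjugators
import Literature.AnabelianGeometry.SemiGraphs.ArithOuterActionOfGraphAction
import Literature.AnabelianGeometry.SemiGraphs.TemperedCompactInVerticialFinite
import HarnessLib

/-!
# [SemiAnbd] Thm 5.4, producer row T54-B: `IsArithCompatible` of the presentation of `𝔾` in `π₁^temp(𝒢)`
# for the outer model DERIVED FROM A GRAPH ACTION ALONE (no chart binder left)

Mochizuki, *Semi-graphs of anabelioids*, Publ. RIMS **42** (2006), §5 Def 5.1 (i) p. 62 ("an action of
`π̂₁(A)` on `𝔾`" by automorphisms of the semi-graph of anabelioids), Prop 5.2 (iv) p. 64, p. 65,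
Thm 5.4 p. 66 [cite: MochizukiSemiAnbd2006, Thm 5.4, p. 66].  abc-iut cell, layer L3, GAP-LEDGER row
G-w4d053-1 (T54-B); seat abc-iut-w4-d053 gen 3.  PROOF-ONLY composition (no definition, no named fact)
of abc-iut-w4-d082's `exists_outerAction_binders_of_graphAction` (ArithOuterActionOfGraphAction.lean:
the outer action `ρ` and the chart binders `hV`/`hE`/`hBR` DERIVED from a pseudo-functorial, locally
surjective action `F` of `Π_A` on `𝒢` over `baseAct`) with this seat's
`isArithCompatible_piPresentation_outerAction_of_branchPair` (TemperedPiEdgeConjugators.lean):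

* `exists_outerAction_isArithCompatible_of_graphAction` — for `𝒢` under the Thm 3.7 hypotheses, a
  graph, with Thm 3.7 (iii) at `𝒢` (`CompactInVerticialAt 𝒢`), and such an action `F`, there is an
  outer action `ρ : Π_A → Out(π₁^temp 𝒢)` satisfying the Def 5.1 (i) chart binders `hV`, `hE`, `hBR`
  AND making abc-iut-L3-d4's presentation `D.piPresentation T R` of `𝔾` in `π₁^temp(𝒢)`
  `IsArithCompatible` with the outer model `π₁^temp(𝒢) ⋊^out_ρ Π_A` — the input `hP` of the arithmetic
  tree tower / the Thm 5.4 capstones, with NO binder on `π₁^temp(𝒢)`-level data.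

* `isArithCompatible_piPresentation_outerAction_of_branchPair_of_finite` /
  `exists_outerAction_isArithCompatible_of_graphAction_of_finite` — for FINITE `𝔾` (the frame of
  Thm 5.4's capstones) Thm 3.7 (iii) at `𝒢` is abc-iut-L3-t8's theorem
  `compactInVerticialAt_of_finiteGraph` (p431007), so `CompactInVerticialAt 𝒢` drops out: `hP` modulo
  {`hV`, `hBR`} resp. modulo the graph action ALONE.

Nothing here takes a side on [IUTchIII] Cor 3.12; typed ≠ proved for Thm 5.4.
-/

namespace Literature.AnabelianGeometry.SemiGraphs

namespace ProfiniteSemiGraph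

open CategoryTheory
open Literature.AnabelianGeometry.EtaleTheta

universe u w

variable {𝒢 : ProfiniteSemiGraph.{u}} (h37 : 𝒢.Thm37Hypotheses)
  {PA : Type w} [Group PA] (F : PA → Hom 𝒢 𝒢) (baseAct : PA →* Aut 𝒢.graph)
  (T : ∀ w : 𝒢.graph.Vertex,
    (𝒢.galoisLevelData h37.toProp36Hypotheses).PointSeq h37.toProp36Hypotheses.isCountable w)
  (R : SemiGraph.RefBranches 𝒢.graph)

/-- **`hP` from a graph action alone**: the outer action `ρ` derived from a pseudo-functorial, locally
surjective action `F` of `Π_A` on `𝒢` over `baseAct` (abc-iut-w4-d082) satisfies the Def 5.1 (i) chart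
binders `hV`, `hE`, `hBR` (stated over `baseAct`) AND makes the presentation of `𝔾` in `π₁^temp(𝒢)`
`IsArithCompatible` with the outer model — for `𝒢` under the Thm 3.7 hypotheses, a graph, with Thm 3.7
(iii) at `𝒢`. [cite: MochizukiSemiAnbd2006, Thm 5.4, p. 66] -/
theorem exists_outerAction_isArithCompatible_of_graphAction (hG : 𝒢.graph.IsGraph)
    (hCIV : CompactInVerticialAt 𝒢) (hbase : ∀ a, (F a).base = (baseAct a).hom)
    (hmul : ∀ a b, Nonempty ((F (a * b)).chartPullback (𝒢.temperedPiChart h37.toProp36Hypotheses)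
        (𝒢.temperedPiChart h37.toProp36Hypotheses) ≅
      (F a).chartPullback (𝒢.temperedPiChart h37.toProp36Hypotheses)
          (𝒢.temperedPiChart h37.toProp36Hypotheses) ⋙
        (F b).chartPullback (𝒢.temperedPiChart h37.toProp36Hypotheses)
          (𝒢.temperedPiChart h37.toProp36Hypotheses)))
    (hone : Nonempty ((F 1).chartPullback (𝒢.temperedPiChart h37.toProp36Hypotheses)
        (𝒢.temperedPiChart h37.toProp36Hypotheses) ≅
      𝟭 (BTemp (𝒢.temperedPiChart h37.toProp36Hypotheses).G)))
    (hVs : ∀ a v, Function.Surjective ((F a).hV v)) (hEs : ∀ a e, Function.Surjective ((F a).hE e)) :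
    ∃ ρ : PA →* TopOut (𝒢.temperedPiChart h37.toProp36Hypotheses).G,
      (∀ (a : PA) (v : 𝒢.graph.Vertex) (H : Subgroup (𝒢.temperedPiChart h37.toProp36Hypotheses).G),
        H ∈ verticialSubgroups (𝒢.temperedPiChart h37.toProp36Hypotheses) v →
        ∃ Φ : contMulAut (𝒢.temperedPiChart h37.toProp36Hypotheses).G, TopOut.mk _ Φ = ρ a ∧
          H.map (Φ : MulAut (𝒢.temperedPiChart h37.toProp36Hypotheses).G).toMonoidHom ∈
            verticialSubgroups (𝒢.temperedPiChart h37.toProp36Hypotheses)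
              ((baseAct a).hom.vertexMap v)) ∧
      (∀ (a : PA) (e : 𝒢.graph.Edge) (K : Subgroup (𝒢.temperedPiChart h37.toProp36Hypotheses).G),
        K ∈ edgeLikeSubgroups (𝒢.temperedPiChart h37.toProp36Hypotheses) e →
        ∃ Φ : contMulAut (𝒢.temperedPiChart h37.toProp36Hypotheses).G, TopOut.mk _ Φ = ρ a ∧
          K.map (Φ : MulAut (𝒢.temperedPiChart h37.toProp36Hypotheses).G).toMonoidHom ∈
            edgeLikeSubgroups (𝒢.temperedPiChart h37.toProp36Hypotheses) ((baseAct a).hom.edgeMap e)) ∧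
      (∀ (a : PA) (b : 𝒢.graph.Branch) (v : 𝒢.graph.Vertex) (hb : 𝒢.graph.abuts b = some v)
        (φ : 𝒢.Gv v →ₜ* (𝒢.temperedPiChart h37.toProp36Hypotheses).G),
        IsVerticialHom (𝒢.temperedPiChart h37.toProp36Hypotheses) v φ →
        ∃ Φ : contMulAut (𝒢.temperedPiChart h37.toProp36Hypotheses).G, TopOut.mk _ Φ = ρ a ∧
          ∃ φ' : 𝒢.Gv ((baseAct a).hom.vertexMap v) →ₜ* (𝒢.temperedPiChart h37.toProp36Hypotheses).G,
            IsVerticialHom (𝒢.temperedPiChart h37.toProp36Hypotheses) ((baseAct a).hom.vertexMap v) φ' ∧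
            ∃ x' : (𝒢.temperedPiChart h37.toProp36Hypotheses).G,
              Subgroup.map (Φ : MulAut (𝒢.temperedPiChart h37.toProp36Hypotheses).G).toMonoidHom
                  φ.toMonoidHom.range =
                Subgroup.map (MulAut.conj x').toMonoidHom φ'.toMonoidHom.range ∧
              Subgroup.map (Φ : MulAut (𝒢.temperedPiChart h37.toProp36Hypotheses).G).toMonoidHom
                  (Subgroup.map φ.toMonoidHom (𝒢.branchSubgroup b v hb)) =
                Subgroup.map (MulAut.conj x').toMonoidHom
                  (Subgroup.map φ'.toMonoidHom
                    (𝒢.branchSubgroup ((baseAct a).hom.branchMap b) ((baseAct a).hom.vertexMap v)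
                      ((baseAct a).hom.abuts_branchMap b v hb)))) ∧
      ((𝒢.galoisLevelData h37.toProp36Hypotheses).piPresentation
          h37.toProp36Hypotheses.isCountable T R).IsArithCompatible
        (((contMulAut (𝒢.temperedPiChart h37.toProp36Hypotheses).G).subtype.comp
          (MonoidHom.fst _ _)).comp (outerSemidirectProduct ρ).subtype)
        (baseAct.comp (outerSemidirectProductSnd ρ)) := by
  obtain ⟨ρ, hV, hE, hBR⟩ := exists_outerAction_binders_of_graphAction
    (𝒢.temperedPiChart h37.toProp36Hypotheses) F h37.toProp36Hypotheses hG hmul hone hVs hEs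
  have hV' : ∀ (a : PA) (v : 𝒢.graph.Vertex) (H : Subgroup (𝒢.temperedPiChart h37.toProp36Hypotheses).G),
      H ∈ verticialSubgroups (𝒢.temperedPiChart h37.toProp36Hypotheses) v →
      ∃ Φ : contMulAut (𝒢.temperedPiChart h37.toProp36Hypotheses).G, TopOut.mk _ Φ = ρ a ∧
        H.map (Φ : MulAut (𝒢.temperedPiChart h37.toProp36Hypotheses).G).toMonoidHom ∈
          verticialSubgroups (𝒢.temperedPiChart h37.toProp36Hypotheses)
            ((baseAct a).hom.vertexMap v) := by
    intro a v H hH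
    rw [← hbase a]
    exact hV a v H hH
  have hE' : ∀ (a : PA) (e : 𝒢.graph.Edge) (K : Subgroup (𝒢.temperedPiChart h37.toProp36Hypotheses).G),
      K ∈ edgeLikeSubgroups (𝒢.temperedPiChart h37.toProp36Hypotheses) e →
      ∃ Φ : contMulAut (𝒢.temperedPiChart h37.toProp36Hypotheses).G, TopOut.mk _ Φ = ρ a ∧
        K.map (Φ : MulAut (𝒢.temperedPiChart h37.toProp36Hypotheses).G).toMonoidHom ∈
          edgeLikeSubgroups (𝒢.temperedPiChart h37.toProp36Hypotheses) ((baseAct a).hom.edgeMap e) := by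
    intro a e K hK
    rw [← hbase a]
    exact hE a e K hK
  have hBR' : ∀ (a : PA) (b : 𝒢.graph.Branch) (v : 𝒢.graph.Vertex) (hb : 𝒢.graph.abuts b = some v)
      (φ : 𝒢.Gv v →ₜ* (𝒢.temperedPiChart h37.toProp36Hypotheses).G),
      IsVerticialHom (𝒢.temperedPiChart h37.toProp36Hypotheses) v φ →
      ∃ Φ : contMulAut (𝒢.temperedPiChart h37.toProp36Hypotheses).G, TopOut.mk _ Φ = ρ a ∧
        ∃ φ' : 𝒢.Gv ((baseAct a).hom.vertexMap v) →ₜ* (𝒢.temperedPiChart h37.toProp36Hypotheses).G,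
          IsVerticialHom (𝒢.temperedPiChart h37.toProp36Hypotheses) ((baseAct a).hom.vertexMap v) φ' ∧
          ∃ x' : (𝒢.temperedPiChart h37.toProp36Hypotheses).G,
            Subgroup.map (Φ : MulAut (𝒢.temperedPiChart h37.toProp36Hypotheses).G).toMonoidHom
                φ.toMonoidHom.range =
              Subgroup.map (MulAut.conj x').toMonoidHom φ'.toMonoidHom.range ∧
            Subgroup.map (Φ : MulAut (𝒢.temperedPiChart h37.toProp36Hypotheses).G).toMonoidHom
                (Subgroup.map φ.toMonoidHom (𝒢.branchSubgroup b v hb)) =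
              Subgroup.map (MulAut.conj x').toMonoidHom
                (Subgroup.map φ'.toMonoidHom
                  (𝒢.branchSubgroup ((baseAct a).hom.branchMap b) ((baseAct a).hom.vertexMap v)
                    ((baseAct a).hom.abuts_branchMap b v hb))) := by
    intro a b v hb φ hφ
    rw [← hbase a]
    exact hBR a b v hb φ hφ
  exact ⟨ρ, hV', hE', hBR',
    isArithCompatible_piPresentation_outerAction_of_branchPair h37 ρ baseAct T R hG hCIV hV' hBR'⟩

/-! ### Finite graphs: Thm 3.7 (iii) at `𝒢` is a theorem, so `CompactInVerticialAt` drops out -/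

/-- **`IsArithCompatible` for the outer model at a FINITE graph, modulo the chart binders `hV`/`hBR`
ONLY** (Thm 3.7 (iii) at `𝒢` := abc-iut-L3-t8's `compactInVerticialAt_of_finiteGraph`).
[cite: MochizukiSemiAnbd2006, Thm 5.4, p. 66] -/
theorem isArithCompatible_piPresentation_outerAction_of_branchPair_of_finite
    [Finite 𝒢.graph.Vertex] [Finite 𝒢.graph.Edge]
    (ρ : PA →* TopOut (𝒢.temperedPiChart h37.toProp36Hypotheses).G) (hG : 𝒢.graph.IsGraph)
    (hV : ∀ (a : PA) (v : 𝒢.graph.Vertex) (H : Subgroup (𝒢.temperedPiChart h37.toProp36Hypotheses).G),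
      H ∈ verticialSubgroups (𝒢.temperedPiChart h37.toProp36Hypotheses) v →
      ∃ φ : contMulAut (𝒢.temperedPiChart h37.toProp36Hypotheses).G, TopOut.mk _ φ = ρ a ∧
        H.map (φ : MulAut (𝒢.temperedPiChart h37.toProp36Hypotheses).G).toMonoidHom ∈
          verticialSubgroups (𝒢.temperedPiChart h37.toProp36Hypotheses) ((baseAct a).hom.vertexMap v))
    (hBR : ∀ (a : PA) (b : 𝒢.graph.Branch) (v : 𝒢.graph.Vertex) (hb : 𝒢.graph.abuts b = some v)
      (φ : 𝒢.Gv v →ₜ* (𝒢.temperedPiChart h37.toProp36Hypotheses).G),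
      IsVerticialHom (𝒢.temperedPiChart h37.toProp36Hypotheses) v φ →
      ∃ Φ : contMulAut (𝒢.temperedPiChart h37.toProp36Hypotheses).G, TopOut.mk _ Φ = ρ a ∧
        ∃ φ' : 𝒢.Gv ((baseAct a).hom.vertexMap v) →ₜ* (𝒢.temperedPiChart h37.toProp36Hypotheses).G,
          IsVerticialHom (𝒢.temperedPiChart h37.toProp36Hypotheses) ((baseAct a).hom.vertexMap v) φ' ∧
          ∃ x' : (𝒢.temperedPiChart h37.toProp36Hypotheses).G,
            Subgroup.map (Φ : MulAut (𝒢.temperedPiChart h37.toProp36Hypotheses).G).toMonoidHom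
                φ.toMonoidHom.range =
              Subgroup.map (MulAut.conj x').toMonoidHom φ'.toMonoidHom.range ∧
            Subgroup.map (Φ : MulAut (𝒢.temperedPiChart h37.toProp36Hypotheses).G).toMonoidHom
                (Subgroup.map φ.toMonoidHom (𝒢.branchSubgroup b v hb)) =
              Subgroup.map (MulAut.conj x').toMonoidHom
                (Subgroup.map φ'.toMonoidHom
                  (𝒢.branchSubgroup ((baseAct a).hom.branchMap b) ((baseAct a).hom.vertexMap v)
                    ((baseAct a).hom.abuts_branchMap b v hb)))) :
    ((𝒢.galoisLevelData h37.toProp36Hypotheses).piPresentation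
        h37.toProp36Hypotheses.isCountable T R).IsArithCompatible
      (((contMulAut (𝒢.temperedPiChart h37.toProp36Hypotheses).G).subtype.comp
        (MonoidHom.fst _ _)).comp (outerSemidirectProduct ρ).subtype)
      (baseAct.comp (outerSemidirectProductSnd ρ)) :=
  isArithCompatible_piPresentation_outerAction_of_branchPair h37 ρ baseAct T R hG
    𝒢.compactInVerticialAt_of_finiteGraph hV hBR

/-- **`hP` from a graph action alone at a FINITE graph**: as
`exists_outerAction_isArithCompatible_of_graphAction`, with Thm 3.7 (iii) at `𝒢` supplied by
`compactInVerticialAt_of_finiteGraph`. [cite: MochizukiSemiAnbd2006, Thm 5.4, p. 66] -/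
theorem exists_outerAction_isArithCompatible_of_graphAction_of_finite
    [Finite 𝒢.graph.Vertex] [Finite 𝒢.graph.Edge] (hG : 𝒢.graph.IsGraph)
    (hbase : ∀ a, (F a).base = (baseAct a).hom)
    (hmul : ∀ a b, Nonempty ((F (a * b)).chartPullback (𝒢.temperedPiChart h37.toProp36Hypotheses)
        (𝒢.temperedPiChart h37.toProp36Hypotheses) ≅
      (F a).chartPullback (𝒢.temperedPiChart h37.toProp36Hypotheses)
          (𝒢.temperedPiChart h37.toProp36Hypotheses) ⋙
        (F b).chartPullback (𝒢.temperedPiChart h37.toProp36Hypotheses)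
          (𝒢.temperedPiChart h37.toProp36Hypotheses)))
    (hone : Nonempty ((F 1).chartPullback (𝒢.temperedPiChart h37.toProp36Hypotheses)
        (𝒢.temperedPiChart h37.toProp36Hypotheses) ≅
      𝟭 (BTemp (𝒢.temperedPiChart h37.toProp36Hypotheses).G)))
    (hVs : ∀ a v, Function.Surjective ((F a).hV v)) (hEs : ∀ a e, Function.Surjective ((F a).hE e)) :
    ∃ ρ : PA →* TopOut (𝒢.temperedPiChart h37.toProp36Hypotheses).G,
      ((𝒢.galoisLevelData h37.toProp36Hypotheses).piPresentation
          h37.toProp36Hypotheses.isCountable T R).IsArithCompatible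
        (((contMulAut (𝒢.temperedPiChart h37.toProp36Hypotheses).G).subtype.comp
          (MonoidHom.fst _ _)).comp (outerSemidirectProduct ρ).subtype)
        (baseAct.comp (outerSemidirectProductSnd ρ)) := by
  obtain ⟨ρ, -, -, -, hP⟩ := exists_outerAction_isArithCompatible_of_graphAction h37 F baseAct T R hG
    𝒢.compactInVerticialAt_of_finiteGraph hbase hmul hone hVs hEs
  exact ⟨ρ, hP⟩

end ProfiniteSemiGraph

end Literature.AnabelianGeometry.SemiGraphs
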